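import Mathlib
import Summits.Ventures.HodgeRepro.Tier4.Line1.DefinedContentOfData
import Summits.Ventures.HodgeRepro.Tier4.Line4.OrbitProper
import Summits.Ventures.HodgeRepro.Tier4.Line4.HorbInteg

/-!
# Tier4/Line4/HorbDefinite — `horb` on a definite row-genuine plane: PROPER discharged by name

Blind re-derivation cell `pub-hodge-repro`, Tier 4 «prove the step» (README §9–§10), seat t4-L2-p1 (gen 3; L4 service
prover).  Tree path `lean/Summits/Ventures/HodgeRepro/Tier4/Line4/HorbDefinite.lean`.  ONE corollary of `horb_of_integ`
(HorbInteg p698867 = Part 9 of plan-4 g3's Integ-Concat-v2): on a DEFINITE, row-genuine plane (`hW`, `hg`) with a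
LINEARLY REGULAR rational `γ₀` (`hreg : IsLinRegular`, the clause LINE L4's skeleton displays), the two binders
`hreg : IsRegularRational W γ₀` and `hprop : HasProperFinOrbit W γ₀` of `horb_of_integ` are THEOREMS —
`Line1.isRegularRational_of_isLinRegular` (DefinedContentOfData p677159, t4-L1-p3) and t4-L2-p3 g4's
`hasProperFinOrbit_of_isDefinite` (OrbitProper p698658, C-L4-PROPER) — so the wall's `horb` binder is priced by the
remaining list: `hF hFc hFs hFinfc hFfinc Cf hCf hFsupp` (the product test function), `hcμ hc0 hcμ' hc0'` (product Haar
normalisations), `hDZf hfd hDZc` (ZDOMAIN-EX), `hreal hnonneg hpos hsupp` (FINPOS′ / FINSUPP), the characters, the two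
`CompactSpace` binders, and the ONE analytic residual `harch`.  Mathlib-level; no literature.

Nothing here says anything about the status of the Hodge conjecture for CM abelian varieties, which is NOT proved
(HC_CM is NOT proved by anyone in this repository).
-/

set_option autoImplicit false
noncomputable section
namespace Summit.Ventures.HodgeRepro.Tier4.Line4
open Summit.Ventures.HodgeRepro.Tier4 Summit.Ventures.HodgeRepro.Tier4.Common
  Summit.Ventures.HodgeRepro.Tier4.Line1 MeasureTheory
open scoped ComplexConjugate Topology Pointwise NNReal

section Definite
variable {k : Type} [Field k] [NumberField k] (W : PlaneData k) [MeasurableSpace (GA W)] [BorelSpace (GA W)]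
  (R : RTFData W) (μ : Measure (GA W)) [μ.IsHaarMeasure] [R.μT.IsHaarMeasure] [R.μT'.IsHaarMeasure]
  (DG : Set (GA W)) (fdG : IsFundamentalDomain (rationalPoints W) DG μ) (compG : IsCompact (closure DG))
  (compT : IsCompact (closure R.DT)) (compT' : IsCompact (closure R.DT'))

/-- **`horb` on a definite row-genuine plane for a linearly regular `γ₀`**: `horb_of_integ` with `hreg` (Jacquet
regularity) and `hprop` (PROPER) discharged by `isRegularRational_of_isLinRegular` and `hasProperFinOrbit_of_isDefinite`. -/
theorem horb_of_integ_definite [MeasurableMul (torusT W)] [MeasurableMul (torusT' W)]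
    [CompactSpace (torusInf W)] [CompactSpace (torusInf' W)]
    (hW : Line1.IsDefinite W) (hg : Line1.IsGenuineRow W)
    (hR : R.IsHaar) (hc : Continuous R.chi) (hu : ∀ a, ‖R.chi a‖ = 1)
    (hc' : Continuous R.chi') (hu' : ∀ a, ‖R.chi' a‖ = 1)
    (F Finf Ffin : GA W → ℂ) (hF : ∀ g, F g = Finf (GA.ofInfPart W g) * Ffin (GA.ofFinPart W g))
    (hFc : Continuous F) (hFs : HasCompactSupport F) (hFinfc : Continuous Finf) (hFfinc : Continuous Ffin)
    (Cf : Set (GA W)) (hCf : IsCompact Cf) (hFsupp : ∀ g ∈ finitePart W, Ffin g ≠ 0 → g ∈ Cf)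
    (γ₀ : rationalPoints W) (hreg : Line1.IsLinRegular W γ₀)
    (νinf : Measure (torusInf W)) [νinf.IsHaarMeasure] (νf : Measure (torusFin W)) [νf.IsHaarMeasure]
    (c : ℝ≥0) (hcμ : R.μT = c • Measure.map (torusSplit W).symm (νinf.prod νf)) (hc0 : c ≠ 0)
    (νinf' : Measure (torusInf' W)) [νinf'.IsHaarMeasure] (νf' : Measure (torusFin' W)) [νf'.IsHaarMeasure]
    (c' : ℝ≥0) (hcμ' : R.μT' = c' • Measure.map (torusSplit' W).symm (νinf'.prod νf')) (hc0' : c' ≠ 0)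
    (DZf : Set (torusFin W)) (hDZf : MeasurableSet DZf) (hfd : IsFundamentalDomain (centreFin W) DZf νf)
    (hDZc : ∀ C : Set (torusFin W), IsCompact C → IsCompact (closure (DZf ∩ (C * (ZfIn W : Set (torusFin W))))))
    (hreal : ∀ g, (Ffin g).im = 0) (hnonneg : ∀ g, 0 ≤ (Ffin g).re)
    (hpos : ∀ b ∈ DZf, ∀ b' : torusFin' W,
      Ffin ((((b : torusT W) : GA W))⁻¹ * GA.ofFinPart W (γ₀ : GA W) * ((b' : torusT' W) : GA W)) ≠ 0 →
      0 < (R.chi b * conj (R.chi' b')).re)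
    (hsupp : 0 < (νf.restrict DZf).prod νf' {p : torusFin W × torusFin' W |
      Ffin ((((p.1 : torusT W) : GA W))⁻¹ * GA.ofFinPart W (γ₀ : GA W) * ((p.2 : torusT' W) : GA W)) ≠ 0})
    (harch : (∫ a : torusInf W, R.chi a * innerInf W R Finf (γ₀ : GA W) νinf' a ∂νinf) ≠ 0) :
    (Setting.ofAdelicData W R μ DG fdG compG compT compT').orbital R.chi R.chi'
      ((Setting.ofAdelicData W R μ DG fdG compG compT compT').orbitOf γ₀) F ≠ 0 :=
  horb_of_integ W R μ DG fdG compG compT compT' hR hc hu hc' hu' F Finf Ffin hF hFc hFs hFinfc hFfinc Cf hCf hFsupp γ₀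
    (isRegularRational_of_isLinRegular W γ₀ hreg) (hasProperFinOrbit_of_isDefinite W hW hg γ₀ hreg) νinf νf c hcμ hc0
    νinf' νf' c' hcμ' hc0' DZf hDZf hfd hDZc hreal hnonneg hpos hsupp harch

end Definite

end Summit.Ventures.HodgeRepro.Tier4.Line4

end
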